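import Literature.AnabelianGeometry.SemiGraphs.GraphOfAnabelioidsComplements
import Literature.AnabelianGeometry.Anabelioids.GaloisFullSubcategory

/-!
# Epimorphisms of `B(𝒢)` are surjective on fibres, componentwise

Proof-only companion of `GraphOfAnabelioids.lean` ([SemiAnbd] Def. 2.1 p. 23), fourth part of the
named fact `bOf_galoisCategory` — axiom (G5) "the fibre functor sends epimorphisms to
surjections" for the basepoints `ρ_v ⋙ β` of `B(𝒢)`.  An epimorphism of `B(𝒢)` is not visibly an
epimorphism componentwise; we show it is surjective on fibres componentwise
(`surjective_fiber_of_epi`) by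

1. gluing the image factorisations `f_v = e_v ≫ m_v`, `f_e = e_e ≫ m_e` of the components
   (they exist and are unique in a Galois category, `Anabelioids.exists_image`,
   `Anabelioids.image_unique`; the pull-back functors `b^*` are exact) to a factorisation
   `f = e ≫ m` in `B(𝒢)` with `m` mono and all components of `e` epi;
2. `m` is mono and epi in `B(𝒢)`; its complement `Z` (`exists_complement`, (G3)) then satisfies
   `inl = inr : Z ⟶ Z ⨿ Z`, so all its constituents have empty fibre, so every component of `m` is
   an isomorphism.
-/

namespace Literature.AnabelianGeometry.SemiGraphs

open CategoryTheory CategoryTheory.Limits CategoryTheory.PreGaloisCategory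
open Literature.AnabelianGeometry.Anabelioids

universe w v₁ u₁ u

namespace SemiGraphOfAnabelioids

variable (𝒢 : SemiGraphOfAnabelioids.{v₁, u₁, u})

/-- **Image factorisation in `B(𝒢)`**: every morphism `f` of `B(𝒢)` factors as `f = e ≫ m` with
`m` a monomorphism and every component of `e` an epimorphism (glued from the image
factorisations of the components). [cite: MochizukiSemiAnbd2006, Def. 2.1 p.23] -/
theorem exists_image_bObj {X Y : 𝒢.BObj} (f : X ⟶ Y) :
    ∃ (I : 𝒢.BObj) (e : X ⟶ I) (m : I ⟶ Y), (∀ v, Epi (e.fS v)) ∧ (∀ e', Epi (e.fT e')) ∧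
      Mono m ∧ e ≫ m = f := by
  -- image factorisations of the components
  have hv := fun v => exists_image
    (GaloisCategory.getFiberFunctor (𝒢.V v) ⋙ FintypeCat.uSwitch.{v₁, u₁}) (f.fS v)
  have he := fun e => exists_image
    (GaloisCategory.getFiberFunctor (𝒢.E e) ⋙ FintypeCat.uSwitch.{v₁, u₁}) (f.fT e)
  choose IS eS mS hepiS hmonoS hfacS using hv
  choose IT eT mT hepiT hmonoT hfacT using he
  -- gluing isomorphisms `b^* I_v ≅ I_e` from uniqueness of images in `𝒢_e`
  have hγ : ∀ (b : 𝒢.graph.Branch) (v : 𝒢.graph.Vertex) (h : 𝒢.graph.abuts b = some v),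
      ∃ γ : (𝒢.pull b v h).pullback.obj (IS v) ≅ IT (𝒢.graph.edgeOf b),
        ((X.ψ b v h).inv ≫ (𝒢.pull b v h).pullback.map (eS v)) ≫ γ.hom = eT (𝒢.graph.edgeOf b) ∧
          γ.hom ≫ mT (𝒢.graph.edgeOf b) = (𝒢.pull b v h).pullback.map (mS v) ≫ (Y.ψ b v h).hom := by
    intro b v h
    haveI := hmonoS v
    haveI := hepiS v
    haveI := hmonoT (𝒢.graph.edgeOf b)
    haveI := hepiT (𝒢.graph.edgeOf b)
    haveI : Epi ((X.ψ b v h).inv ≫ (𝒢.pull b v h).pullback.map (eS v)) := epi_comp _ _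
    haveI : Mono ((𝒢.pull b v h).pullback.map (mS v) ≫ (Y.ψ b v h).hom) := mono_comp _ _
    refine image_unique _ _ (eT (𝒢.graph.edgeOf b)) (mT (𝒢.graph.edgeOf b)) ?_
    rw [hfacT, Category.assoc, ← Category.assoc ((𝒢.pull b v h).pullback.map (eS v)),
      ← Functor.map_comp, hfacS, f.comm b v h, Iso.inv_hom_id_assoc]
  choose γ hγe hγm using hγ
  let I : 𝒢.BObj := { S := IS, T := IT, ψ := γ }
  refine ⟨I,
    { fS := eS, fT := eT, comm := fun b v h => (Iso.inv_comp_eq _).mp (by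
        rw [← Category.assoc]; exact hγe b v h) },
    { fS := mS, fT := mT, comm := fun b v h => (hγm b v h).symm },
    hepiS, hepiT, mono_of_components _ hmonoS hmonoT, ?_⟩
  exact BObj.hom_ext _ _ (funext hfacS) (funext hfacT)

/-- In `B(𝒢)`, if `coprod.inl = coprod.inr : Z ⟶ Z ⨿ Z` then every constituent of `Z` has empty
fibre, i.e. is initial. [cite: MochizukiSemiAnbd2006, Def. 2.1 p.23] -/
theorem isInitial_components_of_inl_eq_inr [HasBinaryCoproducts 𝒢.BObj]
    [∀ v, PreservesColimitsOfShape (Discrete WalkingPair) (𝒢.ρ v)]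
    [∀ e, PreservesColimitsOfShape (Discrete WalkingPair) (𝒢.ρE e)] (Z : 𝒢.BObj)
    (h : (coprod.inl : Z ⟶ Z ⨿ Z) = coprod.inr) :
    (∀ v, Nonempty (IsInitial (Z.S v))) ∧ ∀ e, Nonempty (IsInitial (Z.T e)) := by
  constructor
  · intro v
    let F := GaloisCategory.getFiberFunctor (𝒢.V v)
    have hc : IsColimit (BinaryCofan.mk ((𝒢.ρ v).map (coprod.inl : Z ⟶ Z ⨿ Z))
        ((𝒢.ρ v).map (coprod.inr : Z ⟶ Z ⨿ Z))) :=
      mapIsColimitOfPreservesOfIsColimit _ _ _ (coprodIsCoprod Z Z)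
    obtain ⟨-, -, hdisj⟩ := fiber_binaryCofan F _ _ hc
    change Nonempty (IsInitial ((𝒢.ρ v).obj Z))
    rw [initial_iff_fiber_empty F]
    refine ⟨fun z => ?_⟩
    have hmem : F.map ((𝒢.ρ v).map (coprod.inl : Z ⟶ Z ⨿ Z)) z ∈
        Set.range (F.map ((𝒢.ρ v).map (coprod.inl : Z ⟶ Z ⨿ Z))) ⊓
          Set.range (F.map ((𝒢.ρ v).map (coprod.inr : Z ⟶ Z ⨿ Z))) :=
      ⟨⟨z, rfl⟩, ⟨z, by rw [h]⟩⟩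
    rw [hdisj.inf_eq_bot] at hmem
    exact hmem
  · intro e
    let F := GaloisCategory.getFiberFunctor (𝒢.E e)
    have hc : IsColimit (BinaryCofan.mk ((𝒢.ρE e).map (coprod.inl : Z ⟶ Z ⨿ Z))
        ((𝒢.ρE e).map (coprod.inr : Z ⟶ Z ⨿ Z))) :=
      mapIsColimitOfPreservesOfIsColimit _ _ _ (coprodIsCoprod Z Z)
    obtain ⟨-, -, hdisj⟩ := fiber_binaryCofan F _ _ hc
    change Nonempty (IsInitial ((𝒢.ρE e).obj Z))
    rw [initial_iff_fiber_empty F]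
    refine ⟨fun z => ?_⟩
    have hmem : F.map ((𝒢.ρE e).map (coprod.inl : Z ⟶ Z ⨿ Z)) z ∈
        Set.range (F.map ((𝒢.ρE e).map (coprod.inl : Z ⟶ Z ⨿ Z))) ⊓
          Set.range (F.map ((𝒢.ρE e).map (coprod.inr : Z ⟶ Z ⨿ Z))) :=
      ⟨⟨z, rfl⟩, ⟨z, by rw [h]⟩⟩
    rw [hdisj.inf_eq_bot] at hmem
    exact hmem

/-- In `B(𝒢)`, a morphism which is both a monomorphism and an epimorphism is an isomorphism
componentwise. [cite: MochizukiSemiAnbd2006, Def. 2.1 p.23] -/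
theorem isIso_components_of_mono_of_epi {I Y : 𝒢.BObj} (m : I ⟶ Y) [Mono m] [Epi m] :
    (∀ v, IsIso (m.fS v)) ∧ ∀ e, IsIso (m.fT e) := by
  -- binary coproducts in `B(𝒢)`, preserved by the restriction functors
  obtain ⟨hcopr, hρ, hρE⟩ := 𝒢.hasColimitsOfShape_bObj (J := Discrete WalkingPair)
  haveI : HasBinaryCoproducts 𝒢.BObj := hcopr
  -- the complement of `m`
  obtain ⟨Z, u, ⟨hc⟩⟩ := 𝒢.exists_complement m
  -- two maps `Y ⟶ I ⨿ (Z ⨿ Z)` which agree on `I`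
  let g₁ : Y ⟶ I ⨿ (Z ⨿ Z) :=
    (BinaryCofan.IsColimit.desc' hc coprod.inl (coprod.inl ≫ coprod.inr)).1
  let g₂ : Y ⟶ I ⨿ (Z ⨿ Z) :=
    (BinaryCofan.IsColimit.desc' hc coprod.inl (coprod.inr ≫ coprod.inr)).1
  have hg : g₁ = g₂ := by
    rw [← cancel_epi m]
    exact (BinaryCofan.IsColimit.desc' hc coprod.inl (coprod.inl ≫ coprod.inr)).2.1.trans
      (BinaryCofan.IsColimit.desc' hc coprod.inl (coprod.inr ≫ coprod.inr)).2.1.symm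
  have hu : (coprod.inl : Z ⟶ Z ⨿ Z) ≫ (coprod.inr : Z ⨿ Z ⟶ I ⨿ (Z ⨿ Z)) =
      coprod.inr ≫ coprod.inr :=
    (BinaryCofan.IsColimit.desc' hc coprod.inl (coprod.inl ≫ coprod.inr)).2.2.symm.trans
      ((congrArg (u ≫ ·) hg).trans
        (BinaryCofan.IsColimit.desc' hc coprod.inl (coprod.inr ≫ coprod.inr)).2.2)
  -- `coprod.inr : Z ⨿ Z ⟶ I ⨿ (Z ⨿ Z)` is a monomorphism (componentwise a coproduct inclusion)
  haveI : Mono (coprod.inr : Z ⨿ Z ⟶ I ⨿ (Z ⨿ Z)) := by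
    refine mono_of_components _ (fun v => ?_) (fun e => ?_)
    · exact MonoCoprod.binaryCofan_inr _
        (mapIsColimitOfPreservesOfIsColimit (𝒢.ρ v) _ _ (coprodIsCoprod I (Z ⨿ Z)))
    · exact MonoCoprod.binaryCofan_inr _
        (mapIsColimitOfPreservesOfIsColimit (𝒢.ρE e) _ _ (coprodIsCoprod I (Z ⨿ Z)))
  have hZ := 𝒢.isInitial_components_of_inl_eq_inr Z ((cancel_mono _).mp hu)
  constructor
  · intro v
    obtain ⟨hZv⟩ := hZ.1 v
    have hcv : IsColimit (BinaryCofan.mk ((𝒢.ρ v).map m) ((𝒢.ρ v).map u)) :=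
      mapIsColimitOfPreservesOfIsColimit _ _ _ hc
    exact (BinaryCofan.isColimit_iff_isIso_inl hZv _).mp ⟨hcv⟩
  · intro e
    obtain ⟨hZe⟩ := hZ.2 e
    have hce : IsColimit (BinaryCofan.mk ((𝒢.ρE e).map m) ((𝒢.ρE e).map u)) :=
      mapIsColimitOfPreservesOfIsColimit _ _ _ hc
    exact (BinaryCofan.isColimit_iff_isIso_inl hZe _).mp ⟨hce⟩

/-- **Axiom (G5) for `B(𝒢)`, componentwise** ([SemiAnbd] p. 23, part of "one verifies immediately
that `B(𝒢)` is a connected anabelioid"): an epimorphism of `B(𝒢)` is surjective on fibres at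
every vertex and at every edge, for every basepoint of the constituent anabelioid.
[cite: MochizukiSemiAnbd2006, Def. 2.1 p.23] -/
theorem surjective_fiber_of_epi {X Y : 𝒢.BObj} (f : X ⟶ Y) [Epi f] :
    (∀ (v : 𝒢.graph.Vertex) (F : 𝒢.V v ⥤ FintypeCat.{w}) [FiberFunctor F],
      Function.Surjective (F.map (f.fS v))) ∧
    ∀ (e : 𝒢.graph.Edge) (F : 𝒢.E e ⥤ FintypeCat.{w}) [FiberFunctor F],
      Function.Surjective (F.map (f.fT e)) := by
  obtain ⟨I, e, m, hepiS, hepiT, hmono, hfac⟩ := 𝒢.exists_image_bObj f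
  haveI : Epi m := epi_of_epi_fac hfac
  obtain ⟨hisoS, hisoT⟩ := 𝒢.isIso_components_of_mono_of_epi m
  constructor
  · intro v F _
    haveI := hepiS v
    haveI := hisoS v
    have hfv : f.fS v = e.fS v ≫ m.fS v := (congrArg (fun g => BObj.Hom.fS g v) hfac).symm
    rw [hfv, F.map_comp]
    intro y
    obtain ⟨x, hx⟩ := surjective_on_fiber_of_epi F (e.fS v) (F.map (inv (m.fS v)) y)
    refine ⟨x, ?_⟩
    rw [FintypeCat.comp_apply, hx, ← FintypeCat.comp_apply, ← F.map_comp, IsIso.inv_hom_id,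
      F.map_id, FintypeCat.id_apply]
  · intro e' F _
    haveI := hepiT e'
    haveI := hisoT e'
    have hfe : f.fT e' = e.fT e' ≫ m.fT e' := (congrArg (fun g => BObj.Hom.fT g e') hfac).symm
    rw [hfe, F.map_comp]
    intro y
    obtain ⟨x, hx⟩ := surjective_on_fiber_of_epi F (e.fT e') (F.map (inv (m.fT e')) y)
    refine ⟨x, ?_⟩
    rw [FintypeCat.comp_apply, hx, ← FintypeCat.comp_apply, ← F.map_comp, IsIso.inv_hom_id,
      F.map_id, FintypeCat.id_apply]

end SemiGraphOfAnabelioids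

end Literature.AnabelianGeometry.SemiGraphs
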